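/-
Copyright (c) 2026 the pub-hodgecm-mathlib formalisation cell (harness21).  Prover seat hodgecm-mathlib-K2E3-p04 (g2), Track B ∕ K2-LIT
(build stream 29), h413 = `stmt-HodgeConjecture-24833`, line `K2_E3_EllipticInputs`, unit U4 «Keys» — road I («Keys' own road»: the rank-one intertwining
integral), brick I-3f «THE NUMERATOR OF THE `c`-FUNCTION FACTORS».  2026-09-04.
-/
import Summits.HodgeConjecture.HodgeConjecture.Theorems.K2E3SphericalCFunctionClosedForm   -- ★ p856066 (this base, g2): closed form, shell∕ball geometry (`shell_eq_ball_diff`, `measure_heightBall_succ_succ`)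
import HarnessLib

/-!
# h413 ∕ Track B «K2-LIT», unit U4 «Keys», road I brick I-3f: THE NUMERATOR OF HARISH-CHANDRA'S `c`-FUNCTION FACTORS —
# `c_w(χ) = (μ(B₁) + μ(B_{q}) z∕q)(1 − z∕q)∕(1 − z²)` on `U(Φ₃)(L⁺_v)`, `q = q_w = ‖ϖ‖⁻¹`, `z = χ₁(ϖ)`, for EVERY non-split `v` (any ramification, any residue characteristic)
# [Casselman1995 §6.4; Rogawski1990 §4.5 p. 45; Keys1984 §4]

Cell `pub/hodgecm-mathlib`, crux H413 = `stmt-HodgeConjecture-24833` (lane `--supports … --as helper`), route HCCMUnconditional; dealer K2E3-plan (g1) («Road I files stay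
`--supports 24833 --as helper`», 2026-09-03T23:02Z; 23:40:43Z (d) «U4-f stays with Road I (K2E3-p04) ∕ Road II (K2E3-p05)»).  THEOREMS ONLY (0 def ∕ 0 instance ∕ 0 notation ∕
0 sorry); ★ + Mathlib imports.  ★ p856066 gave `c_w(χ) = μ(B₁) + χ₂(−1)(V₁ t + V₂ t²)∕(1 − z²)` with `t = z‖ϖ‖`, `V_k = μ(S_k)`; here the two shell volumes are traded for ONE ball
volume: `V₁ = μ(B_q) − μ(B₁)` and, by the `q²`-scaling of balls (★ `measure_heightBall_succ_succ`), `V₂ = q² μ(B₁) − μ(B_q)` — after which the numerator FACTORS for free: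
`μ(B₁)(1 − z²) + V₁ t + V₂ t² = (μ(B₁) + μ(B_q)·z∕q)(1 − z∕q)`.  So on the unramified line (`χ₂ = 1`)
  **`c_w(χ) = μ(B₁) · (1 + [B_q : B₁]·z∕q)(1 − z∕q) ∕ (1 − z²)`**,  `[B_q : B₁] = μ(B_q)∕μ(B₁)` = the index of `N(𝒪_v) = {‖u₀₂‖ ≤ 1}` in the subgroup `{‖u₀₂‖ ≤ q}`
— Macdonald's shape with a SINGLE local constant left (inert `E_w∕F_v`, `v ∤ 2`: `q = q_F²`, index `q_F`, giving `(1 + q_F⁻¹z)(1 − q_F⁻²z)∕(1 − z²)`; ramified: `q = q_F`, index `q_F`,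
giving `(1 − q_F⁻¹ z)∕(1 − z)`), valid for every `|z| < 1`.  In particular the zeros of the numerator (`z = q`, `z = −q∕[B_q : B₁]`) are what the `γ`-factor road has to locate.

THE MATHEMATICS.  Notation of ★ p855911 ∕ ★ p856066 (`v` non-split, `ϖ` a uniformiser unit, `a = ‖ϖ‖ = q⁻¹`, height `m`, `B_T = {m ≤ T}`, `S_{n+1} = {m = a^{−(n+1)}}`, `μ` Haar on `N(L⁺_v)`).
* §1 `measureReal_shell_one` ∕ `measureReal_shell_two` — `μ(S₁) = μ(B_{a⁻¹}) − μ(B₁)`, `μ(S₂) = a⁻² μ(B₁) − μ(B_{a⁻¹})` (★ `shell_eq_ball_diff`, ★ `measure_heightBall_succ_succ`, finite balls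
  ★ `measure_heightBall_lt_top`, Mathlib `measureReal_sdiff`).
* §2 **`integral_cellFun_eq_factoredForm`** — `χ₂(−1) = 1`, `χ₁` unramified with `|χ₁| = ‖·‖^s`, `s > 0`, `f` `K_v`-fixed:
  `∫_N f(w₀ u) dμ = (μ(B₁) + μ(B_{a⁻¹})·a z)(1 − a z)(1 − z²)⁻¹ · f(1)` (★ `integral_cellFun_eq_closedForm` + §1 + `ring`).
* §3 **`exists_intertwiningIntegral_sphericalVector_eq_factoredForm_smul`** — the ★ I-2a docking: `J f_K = ((μ(B₁) + μ(B_{a⁻¹}) a z)(1 − a z)(1 − z²)⁻¹ f_K(1)) • f'_K`.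

HONEST LABEL.  HC_CM is proved only modulo the 7 printed citations (2 remaining named inputs: hLiu418 = `stmt-HodgeConjecture-24832`, h413 = `stmt-HodgeConjecture-24833`) until
rung 0 closes; count-neutral infrastructure of road I (no socket is paid by this file).  What it does NOT give: the value of `[B_q : B₁]` (brick I-3d) and the `γ`-factor
`γ(χ) = c_w(χ)·c_{w}(wχ)` (the second factor lives in the divergent cone `|z| > 1`: continuation ∕ Iwahori level — road I-4 ∕ road II).

## References
* [Casselman1995] W. Casselman, *Introduction to the theory of admissible representations of `p`-adic reductive groups* (1995), §6.4 pp. 62–64.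
* [Rogawski1990] J. D. Rogawski, *Automorphic Representations of Unitary Groups in Three Variables* (1990), §4.5 p. 45 (the unramified `c`-function of `U(3)`), §12.2 p. 173.
* [Keys1984] D. Keys, *Principal series representations of special unitary groups over local fields*, Compositio Math. 51 (1984), §4.
* [WeilBNT1967] A. Weil, *Basic Number Theory* (1967), Ch. II §5 Prop. 12.
-/

set_option autoImplicit false
-- the mandated namespace repeats the single-problem summit's segment (`HodgeConjecture.HodgeConjecture`)
set_option linter.dupNamespace false

noncomputable section

open NumberField IsDedekindDomain MeasureTheory
open scoped Matrix NNReal ENNReal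

open Literature.NumberTheory Literature.NumberTheory.Automorphic Literature.NumberTheory.Automorphic.UnitaryGroup
open Literature.NumberTheory.GaloisRepresentations Literature.NumberTheory.GaloisRepresentations.IsNonarchimedeanLocalField

namespace Summit.HodgeConjecture.HodgeConjecture.Cruxes.H413.K2E3SphericalCFunctionFactorization

variable (L : Type) [Field L] [NumberField L] [IsCMField L] (v : HeightOneSpectrum (𝓞 ↥(maximalRealSubfield L)))

/-! ## §1 The two shell volumes through the two ball volumes `μ(B₁)`, `μ(B_{a⁻¹})` -/

set_option synthInstance.maxHeartbeats 400000 in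
set_option maxHeartbeats 4000000 in
-- the matrix-group carrier of `N(L⁺_v)` (class of ★ `K2E3SphericalCFunctionClosedForm.measure_shell_succ_succ`)
/-- **`μ(S₁) = μ(B_{a⁻¹}) − μ(B₁)`** (`v` non-split, `ϖ` a uniformiser unit, `a = ‖ϖ‖`, `μ` Haar): `S₁ = B_{a⁻¹} ∖ B₁` (★ `shell_eq_ball_diff` at `n = 0`) with `B₁ ⊆ B_{a⁻¹}` of finite
measure (★ `measure_heightBall_lt_top`), Mathlib `measureReal_sdiff`. [cite: Casselman1995, §6.4 p. 63] [cite: WeilBNT1967, Ch. II §5 Prop. 12] -/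
theorem measureReal_shell_one (hns : ∀ w : PlacesOver L v, IsCMField.complexConj L • w.1 = w.1)
    (ϖ : (LocalRing L v)ˣ) (hϖ : ∀ w : PlacesOver L v, Valued.v ((ϖ : LocalRing L v) w) = WithZero.exp (-1 : ℤ))
    [MeasurableSpace ↥(cmBorelTriple L 3 v).N] [BorelSpace ↥(cmBorelTriple L 3 v).N] (μ : Measure ↥(cmBorelTriple L 3 v).N) [μ.IsHaarMeasure] :
    μ.real {u : ↥(cmBorelTriple L 3 v).N | (((∏ w' : PlacesOver L v, normAbs (w'.1.adicCompletion L) ((((((u : ↥(unitaryGroupOfForm (conjLocal L (IsCMField.complexConj L) v) (cmLocalForm L 3 v)))) : GL (Fin 3) (LocalRing L v)) : Matrix (Fin 3) (Fin 3) (LocalRing L v)) 0 2) w')) : ℝ≥0) : ℝ) = (((unitModulusChar (LocalRing L v) ϖ : ℝ≥0) : ℝ)⁻¹)} =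
      μ.real {u : ↥(cmBorelTriple L 3 v).N | (((∏ w' : PlacesOver L v, normAbs (w'.1.adicCompletion L) ((((((u : ↥(unitaryGroupOfForm (conjLocal L (IsCMField.complexConj L) v) (cmLocalForm L 3 v)))) : GL (Fin 3) (LocalRing L v)) : Matrix (Fin 3) (Fin 3) (LocalRing L v)) 0 2) w')) : ℝ≥0) : ℝ) ≤ (((unitModulusChar (LocalRing L v) ϖ : ℝ≥0) : ℝ)⁻¹)} - μ.real {u : ↥(cmBorelTriple L 3 v).N | (((∏ w' : PlacesOver L v, normAbs (w'.1.adicCompletion L) ((((((u : ↥(unitaryGroupOfForm (conjLocal L (IsCMField.complexConj L) v) (cmLocalForm L 3 v)))) : GL (Fin 3) (LocalRing L v)) : Matrix (Fin 3) (Fin 3) (LocalRing L v)) 0 2) w')) : ℝ≥0) : ℝ) ≤ 1} := by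
  have ha0 : 0 < ((unitModulusChar (LocalRing L v) ϖ : ℝ≥0) : ℝ) := NNReal.coe_pos.2 distribHaarChar_pos
  have ha1 : ((unitModulusChar (LocalRing L v) ϖ : ℝ≥0) : ℝ) < 1 := by exact_mod_cast K2E3SphericalCFunctionShellExpansion.unitModulusChar_uniformizer_lt_one L v hns ϖ hϖ
  have hq : 1 ≤ (((unitModulusChar (LocalRing L v) ϖ : ℝ≥0) : ℝ)⁻¹) := (one_lt_inv_iff₀.2 ⟨ha0, ha1⟩).le
  have hm : Measurable fun u : ↥(cmBorelTriple L 3 v).N => (((∏ w' : PlacesOver L v, normAbs (w'.1.adicCompletion L) ((((((u : ↥(unitaryGroupOfForm (conjLocal L (IsCMField.complexConj L) v) (cmLocalForm L 3 v)))) : GL (Fin 3) (LocalRing L v)) : Matrix (Fin 3) (Fin 3) (LocalRing L v)) 0 2) w')) : ℝ≥0) : ℝ) :=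
    (F0P3cStCharTSKeys3AnnulusDock.continuous_norm_entry L v).measurable
  have h := K2E3SphericalCFunctionClosedForm.shell_eq_ball_diff L v hns ϖ hϖ 0
  rw [zero_add, pow_one, pow_zero] at h
  rw [h, measureReal_sdiff (fun u hu => by rw [Set.mem_setOf_eq] at hu ⊢; exact hu.trans hq) (measurableSet_le hm measurable_const)
    (K2E3HeightBallVolumeScaling.measure_heightBall_lt_top L v hns μ _).ne]

set_option synthInstance.maxHeartbeats 400000 in
set_option maxHeartbeats 4000000 in
-- the matrix-group carrier of `N(L⁺_v)` (class of ★ `K2E3SphericalCFunctionClosedForm.measure_shell_succ_succ`)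
/-- **`μ(S₂) = a⁻² μ(B₁) − μ(B_{a⁻¹})`** (`v` non-split, `ϖ` a uniformiser unit, `a = ‖ϖ‖`, `μ` Haar): `S₂ = B_{a⁻²} ∖ B_{a⁻¹}` (★ `shell_eq_ball_diff` at `n = 1`) and `μ(B_{a⁻²}) = a⁻² μ(B₁)`
(★ `measure_heightBall_succ_succ` at `n = 0`). [cite: Casselman1995, §6.4 p. 63] [cite: WeilBNT1967, Ch. II §5 Prop. 12] -/
theorem measureReal_shell_two (hns : ∀ w : PlacesOver L v, IsCMField.complexConj L • w.1 = w.1)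
    (ϖ : (LocalRing L v)ˣ) (hϖ : ∀ w : PlacesOver L v, Valued.v ((ϖ : LocalRing L v) w) = WithZero.exp (-1 : ℤ))
    [MeasurableSpace ↥(cmBorelTriple L 3 v).N] [BorelSpace ↥(cmBorelTriple L 3 v).N] (μ : Measure ↥(cmBorelTriple L 3 v).N) [μ.IsHaarMeasure] :
    μ.real {u : ↥(cmBorelTriple L 3 v).N | (((∏ w' : PlacesOver L v, normAbs (w'.1.adicCompletion L) ((((((u : ↥(unitaryGroupOfForm (conjLocal L (IsCMField.complexConj L) v) (cmLocalForm L 3 v)))) : GL (Fin 3) (LocalRing L v)) : Matrix (Fin 3) (Fin 3) (LocalRing L v)) 0 2) w')) : ℝ≥0) : ℝ) = (((unitModulusChar (LocalRing L v) ϖ : ℝ≥0) : ℝ)⁻¹) ^ 2} =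
      (((unitModulusChar (LocalRing L v) ϖ : ℝ≥0) : ℝ) * ((unitModulusChar (LocalRing L v) ϖ : ℝ≥0) : ℝ))⁻¹ * μ.real {u : ↥(cmBorelTriple L 3 v).N | (((∏ w' : PlacesOver L v, normAbs (w'.1.adicCompletion L) ((((((u : ↥(unitaryGroupOfForm (conjLocal L (IsCMField.complexConj L) v) (cmLocalForm L 3 v)))) : GL (Fin 3) (LocalRing L v)) : Matrix (Fin 3) (Fin 3) (LocalRing L v)) 0 2) w')) : ℝ≥0) : ℝ) ≤ 1} - μ.real {u : ↥(cmBorelTriple L 3 v).N | (((∏ w' : PlacesOver L v, normAbs (w'.1.adicCompletion L) ((((((u : ↥(unitaryGroupOfForm (conjLocal L (IsCMField.complexConj L) v) (cmLocalForm L 3 v)))) : GL (Fin 3) (LocalRing L v)) : Matrix (Fin 3) (Fin 3) (LocalRing L v)) 0 2) w')) : ℝ≥0) : ℝ) ≤ (((unitModulusChar (LocalRing L v) ϖ : ℝ≥0) : ℝ)⁻¹)} := by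
  have ha0 : 0 < ((unitModulusChar (LocalRing L v) ϖ : ℝ≥0) : ℝ) := NNReal.coe_pos.2 distribHaarChar_pos
  have ha1 : ((unitModulusChar (LocalRing L v) ϖ : ℝ≥0) : ℝ) < 1 := by exact_mod_cast K2E3SphericalCFunctionShellExpansion.unitModulusChar_uniformizer_lt_one L v hns ϖ hϖ
  have hq : 1 ≤ (((unitModulusChar (LocalRing L v) ϖ : ℝ≥0) : ℝ)⁻¹) := (one_lt_inv_iff₀.2 ⟨ha0, ha1⟩).le
  have hm : Measurable fun u : ↥(cmBorelTriple L 3 v).N => (((∏ w' : PlacesOver L v, normAbs (w'.1.adicCompletion L) ((((((u : ↥(unitaryGroupOfForm (conjLocal L (IsCMField.complexConj L) v) (cmLocalForm L 3 v)))) : GL (Fin 3) (LocalRing L v)) : Matrix (Fin 3) (Fin 3) (LocalRing L v)) 0 2) w')) : ℝ≥0) : ℝ) :=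
    (F0P3cStCharTSKeys3AnnulusDock.continuous_norm_entry L v).measurable
  have h := K2E3SphericalCFunctionClosedForm.shell_eq_ball_diff L v hns ϖ hϖ 1
  rw [one_add_one_eq_two, pow_one] at h
  have hB := K2E3SphericalCFunctionClosedForm.measure_heightBall_succ_succ L v ϖ μ 0
  rw [zero_add, pow_zero] at hB
  have hB' : μ.real {u : ↥(cmBorelTriple L 3 v).N | (((∏ w' : PlacesOver L v, normAbs (w'.1.adicCompletion L) ((((((u : ↥(unitaryGroupOfForm (conjLocal L (IsCMField.complexConj L) v) (cmLocalForm L 3 v)))) : GL (Fin 3) (LocalRing L v)) : Matrix (Fin 3) (Fin 3) (LocalRing L v)) 0 2) w')) : ℝ≥0) : ℝ) ≤ (((unitModulusChar (LocalRing L v) ϖ : ℝ≥0) : ℝ)⁻¹) ^ 2} = (((unitModulusChar (LocalRing L v) ϖ : ℝ≥0) : ℝ) * ((unitModulusChar (LocalRing L v) ϖ : ℝ≥0) : ℝ))⁻¹ * μ.real {u : ↥(cmBorelTriple L 3 v).N | (((∏ w' : PlacesOver L v, normAbs (w'.1.adicCompletion L) ((((((u : ↥(unitaryGroupOfForm (conjLocal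 L (IsCMField.complexConj L) v) (cmLocalForm L 3 v)))) : GL (Fin 3) (LocalRing L v)) : Matrix (Fin 3) (Fin 3) (LocalRing L v)) 0 2) w')) : ℝ≥0) : ℝ) ≤ 1} := by
    rw [measureReal_def, measureReal_def, hB, ENNReal.toReal_mul, ENNReal.toReal_inv, ENNReal.coe_toReal, NNReal.coe_mul]
  rw [h, measureReal_sdiff (fun u hu => by rw [Set.mem_setOf_eq] at hu ⊢; exact hu.trans (le_self_pow₀ hq two_ne_zero))
    (measurableSet_le hm measurable_const) (K2E3HeightBallVolumeScaling.measure_heightBall_lt_top L v hns μ _).ne, hB']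

/-! ## §2 The factored closed form of `∫_N f(w₀ u) dμ` -/

set_option synthInstance.maxHeartbeats 400000 in
set_option maxHeartbeats 8000000 in
-- statement∕proof over the `SmoothInd` carrier of ★ `cmPrincipalSeries` (class of ★ `K2E3SphericalCFunctionClosedForm.integral_cellFun_eq_closedForm`)
/-- **THE FACTORED FORM OF HARISH-CHANDRA'S `c`-FUNCTION INTEGRAL.**  `v` non-split (every residue characteristic, every ramification type), `w₀` of matrix `Φ₃`, `μ` a Haar measure of
`N(L⁺_v)`, `ϖ` a uniformiser unit (`a = ‖ϖ‖ = q⁻¹`), `χ₂` continuous with `χ₂(−1) = 1`, `χ₁` UNRAMIFIED with `|χ₁(x)| = ‖x‖^s`, `s > 0`, `z = χ₁(ϖ)` (`|z| < 1`), `f` a `K_v`-fixed vector of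
★ `cmPrincipalSeries L 3 v (χ₁, χ₂)`.  Then **`∫_N f(w₀ u) dμ = (μ(B₁) + μ(B_{a⁻¹})·a z)·(1 − a z)·(1 − z²)⁻¹ · f(1)`** — ★ `integral_cellFun_eq_closedForm` with §1 substituted; the
numerator `μ(B₁)(1 − z²) + (μ(B_{a⁻¹}) − μ(B₁)) a z + (a⁻²μ(B₁) − μ(B_{a⁻¹})) a² z²` factors as displayed (the `z²`-terms `−μ(B₁)z² + μ(B₁)z²` cancel).  With `μ(B₁) = 1`:
`c_w(χ) = (1 + [B_{q} : B₁] z∕q)(1 − z∕q)∕(1 − z²)`. [cite: Casselman1995, §6.4 pp. 62–64] [cite: Rogawski1990, §4.5 p. 45] [cite: Keys1984, §4] -/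
theorem integral_cellFun_eq_factoredForm (hns : ∀ w : PlacesOver L v, IsCMField.complexConj L • w.1 = w.1)
    (χ₁ : (LocalRing L v)ˣ →* ℂˣ) (χ₂ : ↥(normOneUnits (conjLocal L (IsCMField.complexConj L) v)) →* ℂˣ)
    (h₂ : Continuous fun x => ((χ₂ x : ℂˣ) : ℂ)) (hχ₂ : χ₂ ⟨-1, F0P3cStCharTSBigCellFactorisation.neg_one_mem_normOneUnits (conjLocal L (IsCMField.complexConj L) v)⟩ = 1)
    (hunr : ∀ u ∈ (Submonoid.pi Set.univ (fun w : PlacesOver L v => (w.1.adicCompletionIntegers L).toSubring.toSubmonoid)).units, χ₁ u = 1) {s : ℝ} (hs : 0 < s)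
    (hχ₁ : ∀ x : (LocalRing L v)ˣ, ‖((χ₁ x : ℂˣ) : ℂ)‖ = ((unitModulusChar (LocalRing L v) x : ℝ≥0) : ℝ) ^ s)
    (ϖ : (LocalRing L v)ˣ) (hϖ : ∀ w : PlacesOver L v, Valued.v ((ϖ : LocalRing L v) w) = WithZero.exp (-1 : ℤ))
    (w₀ : ↥(unitaryGroupOfForm (conjLocal L (IsCMField.complexConj L) v) (cmLocalForm L 3 v))) (hw₀ : Units.val (w₀ : GL (Fin 3) (LocalRing L v)) = cmLocalForm L 3 v)
    [MeasurableSpace ↥(cmBorelTriple L 3 v).N] [BorelSpace ↥(cmBorelTriple L 3 v).N] (μ : Measure ↥(cmBorelTriple L 3 v).N) [μ.IsHaarMeasure]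
    (f : haveI := locallyCompactSpace_cmBorelU L 3 v
      Representation.SmoothInd (cmBorelTriple L 3 v).P (Representation.twist (((Representation.trivial ℂ ↥(torusU (conjLocal L (IsCMField.complexConj L) v) (cmLocalForm L 3 v)) ℂ).twist
        (cmTorusCharPair L v χ₁ χ₂)).comp (cmBorelTriple L 3 v).proj) (rootDeltaChar (cmBorelTriple L 3 v).P)))
    (hf : haveI := locallyCompactSpace_cmBorelU L 3 v
      f ∈ (Representation.smoothIndRep (cmBorelTriple L 3 v).P _).fixedPoints (cmLocalIntegralLevel L 3 (Matrix.of fun i j : Fin 3 => if i.val + j.val + 1 = 3 then (1 : L) else 0) v)) :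
    ∫ u : ↥(cmBorelTriple L 3 v).N, f.toFun (w₀ * (u : ↥(unitaryGroupOfForm (conjLocal L (IsCMField.complexConj L) v) (cmLocalForm L 3 v)))) ∂μ =
      ((μ.real {u : ↥(cmBorelTriple L 3 v).N | (((∏ w' : PlacesOver L v, normAbs (w'.1.adicCompletion L) ((((((u : ↥(unitaryGroupOfForm (conjLocal L (IsCMField.complexConj L) v) (cmLocalForm L 3 v)))) : GL (Fin 3) (LocalRing L v)) : Matrix (Fin 3) (Fin 3) (LocalRing L v)) 0 2) w')) : ℝ≥0) : ℝ) ≤ 1} : ℂ) +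
          (μ.real {u : ↥(cmBorelTriple L 3 v).N | (((∏ w' : PlacesOver L v, normAbs (w'.1.adicCompletion L) ((((((u : ↥(unitaryGroupOfForm (conjLocal L (IsCMField.complexConj L) v) (cmLocalForm L 3 v)))) : GL (Fin 3) (LocalRing L v)) : Matrix (Fin 3) (Fin 3) (LocalRing L v)) 0 2) w')) : ℝ≥0) : ℝ) ≤ (((unitModulusChar (LocalRing L v) ϖ : ℝ≥0) : ℝ)⁻¹)} : ℂ) * ((((unitModulusChar (LocalRing L v) ϖ : ℝ≥0) : ℝ) : ℂ) * ((χ₁ ϖ : ℂˣ) : ℂ))) *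
        (1 - (((unitModulusChar (LocalRing L v) ϖ : ℝ≥0) : ℝ) : ℂ) * ((χ₁ ϖ : ℂˣ) : ℂ)) * (1 - ((χ₁ ϖ : ℂˣ) : ℂ) ^ 2)⁻¹ * f.toFun 1 := by
  have ha0 : 0 < ((unitModulusChar (LocalRing L v) ϖ : ℝ≥0) : ℝ) := NNReal.coe_pos.2 distribHaarChar_pos
  have ha1 : ((unitModulusChar (LocalRing L v) ϖ : ℝ≥0) : ℝ) < 1 := by exact_mod_cast K2E3SphericalCFunctionShellExpansion.unitModulusChar_uniformizer_lt_one L v hns ϖ hϖ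
  have hz : ‖((χ₁ ϖ : ℂˣ) : ℂ)‖ < 1 := by rw [hχ₁ ϖ]; exact Real.rpow_lt_one ha0.le ha1 hs
  have hz2 : (1 : ℂ) - ((χ₁ ϖ : ℂˣ) : ℂ) ^ 2 ≠ 0 := by
    intro h
    have h1 : ‖((χ₁ ϖ : ℂˣ) : ℂ) ^ 2‖ < 1 := by rw [norm_pow]; exact pow_lt_one₀ (norm_nonneg _) hz two_ne_zero
    rw [sub_eq_zero] at h
    rw [← h, norm_one] at h1
    exact lt_irrefl _ h1
  have hac : (((unitModulusChar (LocalRing L v) ϖ : ℝ≥0) : ℝ) : ℂ) ≠ 0 := by exact_mod_cast ha0.ne'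
  rw [K2E3SphericalCFunctionClosedForm.integral_cellFun_eq_closedForm L v hns χ₁ χ₂ h₂ hunr hs hχ₁ ϖ hϖ w₀ hw₀ μ f hf, hχ₂, Units.val_one]
  simp only [pow_one]
  rw [measureReal_shell_one L v hns ϖ hϖ μ, measureReal_shell_two L v hns ϖ hϖ μ]
  set M₀ : ℝ := μ.real {u : ↥(cmBorelTriple L 3 v).N | (((∏ w' : PlacesOver L v, normAbs (w'.1.adicCompletion L) ((((((u : ↥(unitaryGroupOfForm (conjLocal L (IsCMField.complexConj L) v) (cmLocalForm L 3 v)))) : GL (Fin 3) (LocalRing L v)) : Matrix (Fin 3) (Fin 3) (LocalRing L v)) 0 2) w')) : ℝ≥0) : ℝ) ≤ 1} with hM₀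
  set M₁ : ℝ := μ.real {u : ↥(cmBorelTriple L 3 v).N | (((∏ w' : PlacesOver L v, normAbs (w'.1.adicCompletion L) ((((((u : ↥(unitaryGroupOfForm (conjLocal L (IsCMField.complexConj L) v) (cmLocalForm L 3 v)))) : GL (Fin 3) (LocalRing L v)) : Matrix (Fin 3) (Fin 3) (LocalRing L v)) 0 2) w')) : ℝ≥0) : ℝ) ≤ (((unitModulusChar (LocalRing L v) ϖ : ℝ≥0) : ℝ)⁻¹)} with hM₁
  push_cast
  field_simp
  ring

/-! ## §3 Harish-Chandra's `c`-function, factored: `J(w, χ) f_K = ((μ(B₁) + μ(B_q) z∕q)(1 − z∕q)∕(1 − z²) · f_K(1)) • f'_K` -/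

set_option synthInstance.maxHeartbeats 400000 in
set_option maxHeartbeats 8000000 in
-- statement∕proof over two `SmoothInd` carriers of ★ `cmPrincipalSeries` (class of ★ `K2E3SphericalCFunctionClosedForm.exists_intertwiningIntegral_sphericalVector_eq_closedForm_smul`)
/-- **HARISH-CHANDRA'S `c`-FUNCTION, FACTORED** (docked on ★ I-2a).  `v` NON-SPLIT, `w₀` of matrix `Φ₃`, `μ` a Haar measure of `N(L⁺_v)`, `ϖ` a uniformiser unit, `a = ‖ϖ‖ = q⁻¹`, `χ₁, χ₂`
continuous, `χ₂(−1) = 1`, `χ₁` UNRAMIFIED with `|χ₁| = ‖·‖^s`, `s > 0`, `z = χ₁(ϖ)`; `f_K ∈ i_G(χ)^{K_v}`, `f'_K ∈ i_G(wχ)^{K_v}` with `f'_K(1) = 1`.  Then the intertwining integral `J` of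
★ RUNG 3 (`J ≠ 0`, `(J f)(g) = ∫_N f(w₀ n g) dμ`) satisfies **`J f_K = ((μ(B₁) + μ(B_{a⁻¹})·a z)(1 − a z)(1 − z²)⁻¹ · f_K(1)) • f'_K`**: normalising `μ(B₁) = 1`, `f_K(1) = 1`,
**`c_w(χ) = (1 + [B_q : B₁]·z∕q)(1 − z∕q) ∕ (1 − z²)`** — Macdonald's formula for the quasi-split `U(3)` up to the one index `[B_q : B₁]` (= `q_F` at an inert `v ∤ 2`, where `q = q_F²`).
★ p856066 §5 + §1. [cite: Casselman1995, §6.4 pp. 62–64] [cite: Rogawski1990, §4.5 p. 45; §12.2 p. 173] [cite: Keys1984, §3–§4] -/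
theorem exists_intertwiningIntegral_sphericalVector_eq_factoredForm_smul (hns : ∀ w : PlacesOver L v, IsCMField.complexConj L • w.1 = w.1)
    (χ₁ : (LocalRing L v)ˣ →* ℂˣ) (χ₂ : ↥(normOneUnits (conjLocal L (IsCMField.complexConj L) v)) →* ℂˣ)
    (h₁ : Continuous fun x => ((χ₁ x : ℂˣ) : ℂ)) (h₂ : Continuous fun x => ((χ₂ x : ℂˣ) : ℂ)) (hχ₂ : χ₂ ⟨-1, F0P3cStCharTSBigCellFactorisation.neg_one_mem_normOneUnits (conjLocal L (IsCMField.complexConj L) v)⟩ = 1)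
    (hunr : ∀ u ∈ (Submonoid.pi Set.univ (fun w : PlacesOver L v => (w.1.adicCompletionIntegers L).toSubring.toSubmonoid)).units, χ₁ u = 1) {s : ℝ} (hs : 0 < s)
    (hχ₁ : ∀ x : (LocalRing L v)ˣ, ‖((χ₁ x : ℂˣ) : ℂ)‖ = ((unitModulusChar (LocalRing L v) x : ℝ≥0) : ℝ) ^ s)
    (ϖ : (LocalRing L v)ˣ) (hϖ : ∀ w : PlacesOver L v, Valued.v ((ϖ : LocalRing L v) w) = WithZero.exp (-1 : ℤ))
    (w₀ : ↥(unitaryGroupOfForm (conjLocal L (IsCMField.complexConj L) v) (cmLocalForm L 3 v))) (hw₀ : Units.val (w₀ : GL (Fin 3) (LocalRing L v)) = cmLocalForm L 3 v)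
    [MeasurableSpace ↥(cmBorelTriple L 3 v).N] [BorelSpace ↥(cmBorelTriple L 3 v).N] (μ : Measure ↥(cmBorelTriple L 3 v).N) [μ.IsHaarMeasure]
    (fK : haveI := locallyCompactSpace_cmBorelU L 3 v
      Representation.SmoothInd (cmBorelTriple L 3 v).P (Representation.twist (((Representation.trivial ℂ ↥(torusU (conjLocal L (IsCMField.complexConj L) v) (cmLocalForm L 3 v)) ℂ).twist
        (cmTorusCharPair L v χ₁ χ₂)).comp (cmBorelTriple L 3 v).proj) (rootDeltaChar (cmBorelTriple L 3 v).P)))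
    (hfK : haveI := locallyCompactSpace_cmBorelU L 3 v
      fK ∈ (Representation.smoothIndRep (cmBorelTriple L 3 v).P _).fixedPoints (cmLocalIntegralLevel L 3 (Matrix.of fun i j : Fin 3 => if i.val + j.val + 1 = 3 then (1 : L) else 0) v))
    (fK' : haveI := locallyCompactSpace_cmBorelU L 3 v
      Representation.SmoothInd (cmBorelTriple L 3 v).P (Representation.twist (((Representation.trivial ℂ ↥(torusU (conjLocal L (IsCMField.complexConj L) v) (cmLocalForm L 3 v)) ℂ).twist
        (cmTorusCharPair L v (conjInvChar (conjLocal L (IsCMField.complexConj L) v) χ₁) χ₂)).comp (cmBorelTriple L 3 v).proj) (rootDeltaChar (cmBorelTriple L 3 v).P)))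
    (hfK' : haveI := locallyCompactSpace_cmBorelU L 3 v
      fK' ∈ (Representation.smoothIndRep (cmBorelTriple L 3 v).P _).fixedPoints (cmLocalIntegralLevel L 3 (Matrix.of fun i j : Fin 3 => if i.val + j.val + 1 = 3 then (1 : L) else 0) v))
    (h1 : fK'.toFun 1 = 1) :
    ∃ J : (cmPrincipalSeries L 3 v (cmTorusCharPair L v χ₁ χ₂)).IntertwiningMap (cmPrincipalSeries L 3 v (cmTorusCharPair L v (conjInvChar (conjLocal L (IsCMField.complexConj L) v) χ₁) χ₂)),
      J ≠ 0 ∧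
      (∀ (f : haveI := locallyCompactSpace_cmBorelU L 3 v
      Representation.SmoothInd (cmBorelTriple L 3 v).P (Representation.twist (((Representation.trivial ℂ ↥(torusU (conjLocal L (IsCMField.complexConj L) v) (cmLocalForm L 3 v)) ℂ).twist
        (cmTorusCharPair L v χ₁ χ₂)).comp (cmBorelTriple L 3 v).proj) (rootDeltaChar (cmBorelTriple L 3 v).P)))
        (g : ↥(unitaryGroupOfForm (conjLocal L (IsCMField.complexConj L) v) (cmLocalForm L 3 v))),
        (J f).toFun g = ∫ n : ↥(cmBorelTriple L 3 v).N, f.toFun (w₀ * (n : ↥(unitaryGroupOfForm (conjLocal L (IsCMField.complexConj L) v) (cmLocalForm L 3 v))) * g) ∂μ) ∧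
      J fK = (((μ.real {u : ↥(cmBorelTriple L 3 v).N | (((∏ w' : PlacesOver L v, normAbs (w'.1.adicCompletion L) ((((((u : ↥(unitaryGroupOfForm (conjLocal L (IsCMField.complexConj L) v) (cmLocalForm L 3 v)))) : GL (Fin 3) (LocalRing L v)) : Matrix (Fin 3) (Fin 3) (LocalRing L v)) 0 2) w')) : ℝ≥0) : ℝ) ≤ 1} : ℂ) +
          (μ.real {u : ↥(cmBorelTriple L 3 v).N | (((∏ w' : PlacesOver L v, normAbs (w'.1.adicCompletion L) ((((((u : ↥(unitaryGroupOfForm (conjLocal L (IsCMField.complexConj L) v) (cmLocalForm L 3 v)))) : GL (Fin 3) (LocalRing L v)) : Matrix (Fin 3) (Fin 3) (LocalRing L v)) 0 2) w')) : ℝ≥0) : ℝ) ≤ (((unitModulusChar (LocalRing L v) ϖ : ℝ≥0) : ℝ)⁻¹)} : ℂ) * ((((unitModulusChar (LocalRing L v) ϖ : ℝ≥0) : ℝ) : ℂ) * ((χ₁ ϖ : ℂˣ) : ℂ))) *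
        (1 - (((unitModulusChar (LocalRing L v) ϖ : ℝ≥0) : ℝ) : ℂ) * ((χ₁ ϖ : ℂˣ) : ℂ)) * (1 - ((χ₁ ϖ : ℂˣ) : ℂ) ^ 2)⁻¹ * fK.toFun 1) • fK' := by
  obtain ⟨J, hJ, hJint, hJK⟩ := K2E3IntertwiningIntegralSphericalLine.exists_intertwiningIntegral_sphericalVector_eq_smul L v hns χ₁ χ₂ h₁ h₂ hs hχ₁ w₀ hw₀ μ
    fK hfK fK' hfK' h1
  refine ⟨J, hJ, hJint, ?_⟩
  rw [hJK, integral_cellFun_eq_factoredForm L v hns χ₁ χ₂ h₂ hχ₂ hunr hs hχ₁ ϖ hϖ w₀ hw₀ μ fK hfK]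

end Summit.HodgeConjecture.HodgeConjecture.Cruxes.H413.K2E3SphericalCFunctionFactorization

end
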